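import Summits.KontsevichZagierPeriods.KontsevichZagierPeriods.Theorems.LinRedNormalFormArrangementNormalFormSeparateTwoHISector
import Summits.KontsevichZagierPeriods.KontsevichZagierPeriods.Theorems.LinRedNormalFormArrangementNormalFormSeparateTwoHINum

/-!
# The Taylor pieces on the thin sectors at a point of the pole line

(Line `janus-bands`, crux `ArrangementNormalForm`, stub `stub_separateTwoPos_hI`, part `HIPole`.)
At a base point `x₁` ON the pole line `y = l₁ x + l₂`, with the numerator in double Taylor form
`∑_{i<N} (∑_{m<N'} cc(i,m) ξ^m) λ^i` and the wall block factored as `ξ^E W₁(ξ)` (`W₁(0) ≠ 0`),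
the density `g = 𝟙_Y (∑ |Ri i|) m` (part `HISector`) has finite integral over
* the thin sectors of finite slope `sector x₁ (P₀, P₀ l₁ + s) (0, σ) δ [0, ε)` (`hsector_pole`:
  along them `ξ = t P₀`, `λ = t (s + σ v)`, the numerator is the `usum` of part `HINum` with
  `π = fst`, the denominator is `t^{E+n} |s + σ v|^n ω` with `ω = |P₀|^E |W₁(t P₀)|`; ray
  theorems `ray_pole_zero` (`s = 0`) / `ray_pole_order` (`s ≠ 0`), combined as `ray_pole`);
* the vertical thin sectors `sector x₁ (0, p) (q₀, q₀ l₁) δ [0, ε)` (`vsector_pole`: `ξ = t v q₀`,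
  `λ = t p`, `π = snd`, denominator `t^{E+n} |v|^E ω`, `ω = |q₀|^E |p|^n |W₁(t v q₀)|`;
  `ray_pole_zero`),
for every small `(δ, ε)` satisfying explicit smallness conditions and the inside/outside
dichotomy of the sign lemma. Registered in literal form as `separateTwo_hiPole`.
-/

noncomputable section

open Set MeasureTheory
open scoped ENNReal

namespace Summit.KontsevichZagierPeriods.ArrangementNormalForm.JanusBands

namespace SepTwo

/-! ### Small tools -/

/-- The two ray theorems at a point of the pole line, combined. -/
theorem ray_pole (T : Finset (ℕ × ℕ)) (κ : ℕ × ℕ → ℝ) (π : ℕ × ℕ → ℕ) (d : ℕ)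
    (hdeg : ∀ im ∈ T, im.1 + im.2 ≤ d) (hπ : ∀ im ∈ T, π im ≤ d)
    (hinj : ∀ im ∈ T, ∀ im' ∈ T, im.1 + im.2 = im'.1 + im'.2 → π im = π im' → im = im')
    (D M : ℕ) {s σ : ℝ} (hσ : |σ| = 1) (hs : s = 0 ∨ (s ≠ 0 ∧ |s| ≤ 2)) {ω : ℝ → ℝ → ℝ}
    (hωm : Measurable (Function.uncurry ω)) {Λ' : ℝ → ℝ → ℝ≥0∞}
    (hΛm : Measurable (Function.uncurry Λ')) {δ ε : ℝ} (hε : 0 < ε) (hδ1 : 4 * δ ≤ 1)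
    (hε1 : 4 * ε ≤ 1) (hεs : s ≠ 0 → 4 * ε ≤ |s| / 2) {ωlo ωhi : ℝ} (hωlo : 0 < ωlo)
    (hω : ∀ t ∈ Ioo (0 : ℝ) (4 * δ), ∀ v ∈ Ioo (0 : ℝ) (4 * ε), ωlo ≤ ω t v ∧ ω t v ≤ ωhi)
    (KΛ : ℝ≥0∞) (hKΛ : KΛ ≠ ∞)
    (hΛmono : ∀ x v x' v', 0 < x → x ≤ x' → x' ≤ 4 * x → x' < 4 * δ → 0 < v → v ≤ v' →
      v' ≤ 4 * v → v' < 4 * ε → Λ' x v ≤ KΛ * Λ' x' v')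
    (Kn : ℕ) (CΛ : ℝ≥0∞) (hCΛ : CΛ ≠ ∞)
    (hΛang : ∀ x, 0 < x → x < δ → ∀ v v', 0 < v → v ≤ v' → v' < ε →
      Λ' x v ≤ CΛ * ENNReal.ofReal ((1 + Real.log (v' / v)) ^ Kn) * Λ' x v')
    (hfin : ∫⁻ t in Ioo 0 (4 * δ), ∫⁻ v in Ioo 0 (4 * ε),
      ENNReal.ofReal |usum T κ π t (s + σ * v)| * wt D M s σ ω Λ' t v < ∞) (i : ℕ) :
    ∫⁻ t in Ioo 0 δ, ∫⁻ v in Ioo 0 ε, ENNReal.ofReal |usum (T.filter fun im => im.1 = i) κ π t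
      (s + σ * v)| * wt D M s σ ω Λ' t v < ∞ := by
  rcases hs with rfl | ⟨hs0, hs2⟩
  · exact ray_pole_zero T κ π d hdeg hπ hinj D M hσ hωm hΛm hωlo hω KΛ hKΛ hΛmono hfin i
  · exact ray_pole_order T κ π d hdeg hπ hinj D M hσ hs2 hs0 hωm hΛm hε hδ1 hε1 (hεs hs0) hωlo hω
      KΛ hKΛ hΛmono Kn CΛ hCΛ hΛang hfin i

/-- The transversal coordinate does not vanish on the sector. -/
theorem u_pos {s σ ε v : ℝ} (hσ : |σ| = 1) (hs : s = 0 ∨ 4 * ε ≤ |s| / 2) (hv : 0 < v)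
    (hvε : v < 4 * ε) : 0 < |s + σ * v| :=
  (u_bounds hσ hs hv le_rfl (by linarith) hvε).1

/-- The base polygon is measurable. -/
theorem measurableSet_Y {m' : ℕ} (M : Fin m' → Atm 2) :
    MeasurableSet {x : Fin 2 → ℝ | ∀ j, 0 < av x (M j)} := by
  have : {x : Fin 2 → ℝ | ∀ j, 0 < av x (M j)} = ⋂ j, {x | 0 < av x (M j)} := by ext x; simp
  rw [this]
  exact MeasurableSet.iInter fun j => measurableSet_lt measurable_const (measurable_av _)

/-- Shrinking the range of the dichotomy. -/
theorem Ioo_four {δ t : ℝ} (hδ : 0 < δ) (ht : t ∈ Ioo (0 : ℝ) δ) : t ∈ Ioo (0 : ℝ) (4 * δ) :=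
  ⟨ht.1, by linarith [ht.2]⟩

/-! ### Sectors of finite slope -/

/-- First coordinate along a sector of finite slope. -/
theorem hframe_fst (x₁ : Fin 2 → ℝ) (P₀ l₁ s σ t v : ℝ) :
    bpt x₁ ![P₀, P₀ * l₁ + s] ![0, σ] t v 0 - x₁ 0 = t * P₀ := by
  simp [bpt]

/-- The pole coordinate along a sector of finite slope. -/
theorem hframe_lam (x₁ : Fin 2 → ℝ) (P₀ l₁ l₂ s σ t v : ℝ) :
    bpt x₁ ![P₀, P₀ * l₁ + s] ![0, σ] t v 1 - (l₁ * bpt x₁ ![P₀, P₀ * l₁ + s] ![0, σ] t v 0 + l₂) =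
      (x₁ 1 - (l₁ * x₁ 0 + l₂)) + t * (s + σ * v) := by
  simp [bpt]; ring

/-- The determinant of a frame of finite slope. -/
theorem hframe_det (P₀ l₁ s σ : ℝ) :
    (![P₀, P₀ * l₁ + s] : Fin 2 → ℝ) 0 * (![0, σ] : Fin 2 → ℝ) 1 -
      (![0, σ] : Fin 2 → ℝ) 0 * (![P₀, P₀ * l₁ + s] : Fin 2 → ℝ) 1 = P₀ * σ := by
  simp

/-- The denominator along a sector of finite slope at a pole point. -/
theorem hframe_den {E n : ℕ} {W₁ : ℝ → ℝ} {P₀ s σ t v : ℝ} (ht : 0 < t) (hu : 0 < |s + σ * v|)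
    (hW : 0 < |W₁ (t * P₀)|) (hP₀ : P₀ ≠ 0) :
    |(t * P₀) ^ E * W₁ (t * P₀) * (t * (s + σ * v)) ^ n| =
      t ^ (E + n) * |s + σ * v| ^ n * (|P₀| ^ E * |W₁ (t * P₀)|) ∧
    0 < t ^ (E + n) * |s + σ * v| ^ n * (|P₀| ^ E * |W₁ (t * P₀)|) := by
  refine ⟨?_, by have := abs_pos.2 hP₀; positivity⟩
  rw [abs_mul, abs_mul, abs_pow, abs_pow, abs_mul, abs_mul, abs_of_pos ht, mul_pow, mul_pow,
    pow_add]
  ring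

/-- **The density on a thin sector of finite slope at a point of the pole line is finite.** -/
theorem hsector_pole {k m' : ℕ} (M : Fin m' → Atm 2) (lo hi : Fin k → Fin k ⊕ Atm 2)
    (a : Fin k → Option (Atm 2)) (N N' : ℕ) (cc : ℕ × ℕ → ℝ) (E n : ℕ) (W₁ : ℝ → ℝ)
    (l₁ l₂ : ℝ) (x₁ : Fin 2 → ℝ) (R : (Fin 2 → ℝ) → ℝ) (Ri : ℕ → (Fin 2 → ℝ) → ℝ)
    (hlam : x₁ 1 - (l₁ * x₁ 0 + l₂) = 0)
    (hR : ∀ x, R x = (∑ i ∈ Finset.range N, (∑ m ∈ Finset.range N', cc (i, m) * (x 0 - x₁ 0) ^ m) *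
      (x 1 - (l₁ * x 0 + l₂)) ^ i) / ((x 0 - x₁ 0) ^ E * W₁ (x 0 - x₁ 0) * (x 1 - (l₁ * x 0 + l₂)) ^ n))
    (hRi : ∀ i ∈ Finset.range N, ∀ x, Ri i x = (∑ m ∈ Finset.range N', cc (i, m) * (x 0 - x₁ 0) ^ m) *
      (x 1 - (l₁ * x 0 + l₂)) ^ i / ((x 0 - x₁ 0) ^ E * W₁ (x 0 - x₁ 0) * (x 1 - (l₁ * x 0 + l₂)) ^ n))
    (hRm : Measurable R) (hRim : ∀ i, Measurable (Ri i)) (hW₁c : Continuous W₁) (hW₁0 : W₁ 0 ≠ 0)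
    {ρW CW : ℝ} (hWb : ∀ u : ℝ, |u| < ρW → |W₁ 0| / 2 ≤ |W₁ u| ∧ |W₁ u| ≤ CW)
    (hfinY : ∫⁻ x in {x | ∀ j, 0 < av x (M j)}, ENNReal.ofReal |R x| * lmass lo hi a (av x) < ∞)
    {P₀ s σ : ℝ} (hP₀ : P₀ ≠ 0) (hσ : |σ| = 1) (hs : s = 0 ∨ (s ≠ 0 ∧ |s| ≤ 2))
    (P Q : Fin 2 → ℝ) (hP : P = ![P₀, P₀ * l₁ + s]) (hQ : Q = ![0, σ])
    {δ₀ ε₀ : ℝ} {KΛ CΛ : ℝ≥0∞} {Kn : ℕ} (hKΛ : KΛ ≠ ∞) (hCΛ : CΛ ≠ ∞)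
    (hmono : ∀ δ ε : ℝ, 4 * δ ≤ δ₀ → 4 * ε ≤ ε₀ → ∀ x v x' v' : ℝ, 0 < x → x ≤ x' → x' ≤ 4 * x →
      x' < 4 * δ → 0 < v → v ≤ v' → v' ≤ 4 * v → v' < 4 * ε →
      lmass lo hi a (av (bpt x₁ P Q x v)) ≤ KΛ * lmass lo hi a (av (bpt x₁ P Q x' v')))
    (hang : ∀ δ ε : ℝ, δ ≤ δ₀ → ε ≤ ε₀ → ∀ x : ℝ, 0 < x → x < δ → ∀ v v' : ℝ, 0 < v → v ≤ v' →
      v' < ε → lmass lo hi a (av (bpt x₁ P Q x v)) ≤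
        CΛ * ENNReal.ofReal ((1 + Real.log (v' / v)) ^ Kn) * lmass lo hi a (av (bpt x₁ P Q x v')))
    {δ ε : ℝ} (hδ : 0 < δ) (hε : 0 < ε) (h4δ : 4 * δ ≤ δ₀) (h4ε : 4 * ε ≤ ε₀)
    (hδW : 4 * δ * |P₀| ≤ ρW) (hδ1 : 4 * δ ≤ 1) (hε1 : 4 * ε ≤ 1) (hεs : s ≠ 0 → 4 * ε ≤ |s| / 2)
    (hsign : (∀ t ∈ Ioo (0 : ℝ) (4 * δ), ∀ v ∈ Ioo (0 : ℝ) (4 * ε),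
        bpt x₁ P Q t v ∈ {x : Fin 2 → ℝ | ∀ j, 0 < av x (M j)}) ∨
      (∀ t ∈ Ioo (0 : ℝ) (4 * δ), ∀ v ∈ Ioo (0 : ℝ) (4 * ε),
        bpt x₁ P Q t v ∉ {x : Fin 2 → ℝ | ∀ j, 0 < av x (M j)})) :
    ∫⁻ z in sector x₁ P Q δ (Ico 0 ε), {x : Fin 2 → ℝ | ∀ j, 0 < av x (M j)}.indicator
      (fun x => (∑ i ∈ Finset.range N, ENNReal.ofReal |Ri i x|) * lmass lo hi a (av x)) z < ∞ := by
  have hYm := measurableSet_Y M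
  set m : (Fin 2 → ℝ) → ℝ≥0∞ := fun x => lmass lo hi a (av x) with hm_def
  have hm : Measurable m := measurable_lmass_av lo hi a
  have hdet : P 0 * Q 1 - Q 0 * P 1 ≠ 0 := by
    rw [hP, hQ, hframe_det]; exact mul_ne_zero hP₀ (sigma_ne_zero hσ)
  rcases hsign with hin4 | hout
  swap
  · rw [sector_zero N x₁ P Q hYm hm hRim hdet fun t ht v hv => hout t (Ioo_four hδ ht) v (Ioo_four hε hv)]
    exact ENNReal.zero_lt_top
  have hin : ∀ t ∈ Ioo (0 : ℝ) δ, ∀ v ∈ Ioo (0 : ℝ) ε,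
      bpt x₁ P Q t v ∈ {x : Fin 2 → ℝ | ∀ j, 0 < av x (M j)} := fun t ht v hv =>
    hin4 t (Ioo_four hδ ht) v (Ioo_four hε hv)
  refine sector_finite N x₁ P Q hYm hm hRim hdet hin ?_
  have hfin := hfin_of_inside x₁ P Q hm hRm hfinY hdet hin4
  -- the data of the ray theorems
  set T := Finset.range N ×ˢ Finset.range N' with hT
  set κ' : ℕ × ℕ → ℝ := fun im => cc im * P₀ ^ im.2 with hκ'
  set ω : ℝ → ℝ → ℝ := fun t _ => |P₀| ^ E * |W₁ (t * P₀)| with hω_def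
  set Λ' : ℝ → ℝ → ℝ≥0∞ := fun t v => m (bpt x₁ P Q t v) with hΛ'
  have hωm : Measurable (Function.uncurry ω) := by
    refine Measurable.const_mul ?_ _
    exact continuous_abs.measurable.comp (hW₁c.measurable.comp (measurable_fst.mul_const _))
  have hΛm : Measurable (Function.uncurry Λ') := measurable_lmass_bpt lo hi a x₁ P Q
  have hWt : ∀ t ∈ Ioo (0 : ℝ) (4 * δ), |W₁ 0| / 2 ≤ |W₁ (t * P₀)| ∧ |W₁ (t * P₀)| ≤ CW := by
    intro t ht
    refine hWb _ ?_
    rw [abs_mul, abs_of_pos ht.1]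
    calc t * |P₀| < 4 * δ * |P₀| := mul_lt_mul_of_pos_right ht.2 (abs_pos.2 hP₀)
      _ ≤ ρW := hδW
  have hW0 : 0 < |W₁ 0| / 2 := half_pos (abs_pos.2 hW₁0)
  have hωlo : 0 < |P₀| ^ E * (|W₁ 0| / 2) := mul_pos (pow_pos (abs_pos.2 hP₀) E) hW0
  have hω : ∀ t ∈ Ioo (0 : ℝ) (4 * δ), ∀ v ∈ Ioo (0 : ℝ) (4 * ε),
      |P₀| ^ E * (|W₁ 0| / 2) ≤ ω t v ∧ ω t v ≤ |P₀| ^ E * CW := fun t ht v _ =>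
    ⟨mul_le_mul_of_nonneg_left (hWt t ht).1 (by positivity),
      mul_le_mul_of_nonneg_left (hWt t ht).2 (by positivity)⟩
  have hs' : s = 0 ∨ 4 * ε ≤ |s| / 2 := by
    rcases hs with h | ⟨h0, -⟩
    · exact Or.inl h
    · exact Or.inr (hεs h0)
  have hden : ∀ t ∈ Ioo (0 : ℝ) (4 * δ), ∀ v ∈ Ioo (0 : ℝ) (4 * ε),
      |(t * P₀) ^ E * W₁ (t * P₀) * (t * (s + σ * v)) ^ n| = t ^ (E + n) * |s + σ * v| ^ n * ω t v ∧
      0 < t ^ (E + n) * |s + σ * v| ^ n * ω t v := fun t ht v hv =>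
    hframe_den ht.1 (u_pos hσ hs' hv.1 hv.2) (hW0.trans_le (hWt t ht).1) hP₀
  -- the integrand and the pieces in blown-up coordinates
  have hR' : ∀ t ∈ Ioo (0 : ℝ) (4 * δ), ∀ v ∈ Ioo (0 : ℝ) (4 * ε),
      ENNReal.ofReal t * (ENNReal.ofReal |R (bpt x₁ P Q t v)| * m (bpt x₁ P Q t v)) =
        ENNReal.ofReal |usum T κ' Prod.fst t (s + σ * v)| * wt (E + n) n s σ ω Λ' t v := by
    intro t ht v hv
    rw [hR, hP, hQ, hframe_fst, hframe_lam, hlam, zero_add, dsum_fst cc N N' P₀ t (s + σ * v)]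
    simp only [wt, phi]
    rw [← hP, ← hQ]
    exact piece_eq_wt ht.1.le rfl (hden t ht v hv).1 (hden t ht v hv).2 _
  have hRi' : ∀ i ∈ Finset.range N, ∀ t ∈ Ioo (0 : ℝ) δ, ∀ v ∈ Ioo (0 : ℝ) ε,
      ENNReal.ofReal t * (ENNReal.ofReal |Ri i (bpt x₁ P Q t v)| * m (bpt x₁ P Q t v)) =
        ENNReal.ofReal |usum (T.filter fun im => im.1 = i) κ' Prod.fst t (s + σ * v)| *
          wt (E + n) n s σ ω Λ' t v := by
    intro i hi t ht v hv
    rw [hRi i hi, hP, hQ, hframe_fst, hframe_lam, hlam, zero_add,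
      piece_fst cc N N' P₀ t (s + σ * v) i (Finset.mem_range.1 hi)]
    simp only [wt, phi]
    rw [← hP, ← hQ]
    exact piece_eq_wt ht.1.le rfl (hden t (Ioo_four hδ ht) v (Ioo_four hε hv)).1
      (hden t (Ioo_four hδ ht) v (Ioo_four hε hv)).2 _
  have hmono' := hmono δ ε h4δ h4ε
  have hang' := hang δ ε (by linarith) (by linarith)
  exact step_pole N x₁ P Q T κ' Prod.fst (E + n) n s σ ω Λ' hR' hRi'
    (ray_pole T κ' Prod.fst (N + N') (deg_prod N N') (fst_le_prod N N') (inj_fst T) (E + n) n hσ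
      hs hωm hΛm hε hδ1 hε1 hεs hωlo hω KΛ hKΛ hmono' Kn CΛ hCΛ hang') hfin

/-! ### Vertical sectors -/

/-- First coordinate along a vertical sector. -/
theorem vframe_fst (x₁ : Fin 2 → ℝ) (p q₀ l₁ t v : ℝ) :
    bpt x₁ ![0, p] ![q₀, q₀ * l₁] t v 0 - x₁ 0 = t * (v * q₀) := by
  simp [bpt]

/-- The pole coordinate along a vertical sector. -/
theorem vframe_lam (x₁ : Fin 2 → ℝ) (p q₀ l₁ l₂ t v : ℝ) :
    bpt x₁ ![0, p] ![q₀, q₀ * l₁] t v 1 - (l₁ * bpt x₁ ![0, p] ![q₀, q₀ * l₁] t v 0 + l₂) =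
      (x₁ 1 - (l₁ * x₁ 0 + l₂)) + t * p := by
  simp [bpt]; ring

/-- The determinant of a vertical frame. -/
theorem vframe_det (p q₀ l₁ : ℝ) :
    (![0, p] : Fin 2 → ℝ) 0 * (![q₀, q₀ * l₁] : Fin 2 → ℝ) 1 -
      (![q₀, q₀ * l₁] : Fin 2 → ℝ) 0 * (![0, p] : Fin 2 → ℝ) 1 = -(q₀ * p) := by
  simp

/-- The denominator along a vertical sector at a pole point. -/
theorem vframe_den {E n : ℕ} {W₁ : ℝ → ℝ} {p q₀ t v : ℝ} (ht : 0 < t) (hv : 0 < v)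
    (hW : 0 < |W₁ (t * (v * q₀))|) (hp : p ≠ 0) (hq₀ : q₀ ≠ 0) :
    |(t * (v * q₀)) ^ E * W₁ (t * (v * q₀)) * (t * p) ^ n| =
      t ^ (E + n) * |v| ^ E * (|q₀| ^ E * |p| ^ n * |W₁ (t * (v * q₀))|) ∧
    0 < t ^ (E + n) * |v| ^ E * (|q₀| ^ E * |p| ^ n * |W₁ (t * (v * q₀))|) := by
  refine ⟨?_, by have := abs_pos.2 hp; have := abs_pos.2 hq₀; have := abs_pos.2 hv.ne'; positivity⟩
  rw [abs_mul, abs_mul, abs_pow, abs_pow, abs_mul, abs_mul, abs_mul, abs_of_pos ht, mul_pow, mul_pow,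
    mul_pow, pow_add]
  ring

/-- **The density on a vertical thin sector at a point of the pole line is finite.** -/
theorem vsector_pole {k m' : ℕ} (M : Fin m' → Atm 2) (lo hi : Fin k → Fin k ⊕ Atm 2)
    (a : Fin k → Option (Atm 2)) (N N' : ℕ) (cc : ℕ × ℕ → ℝ) (E n : ℕ) (W₁ : ℝ → ℝ)
    (l₁ l₂ : ℝ) (x₁ : Fin 2 → ℝ) (R : (Fin 2 → ℝ) → ℝ) (Ri : ℕ → (Fin 2 → ℝ) → ℝ)
    (hlam : x₁ 1 - (l₁ * x₁ 0 + l₂) = 0)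
    (hR : ∀ x, R x = (∑ i ∈ Finset.range N, (∑ m ∈ Finset.range N', cc (i, m) * (x 0 - x₁ 0) ^ m) *
      (x 1 - (l₁ * x 0 + l₂)) ^ i) / ((x 0 - x₁ 0) ^ E * W₁ (x 0 - x₁ 0) * (x 1 - (l₁ * x 0 + l₂)) ^ n))
    (hRi : ∀ i ∈ Finset.range N, ∀ x, Ri i x = (∑ m ∈ Finset.range N', cc (i, m) * (x 0 - x₁ 0) ^ m) *
      (x 1 - (l₁ * x 0 + l₂)) ^ i / ((x 0 - x₁ 0) ^ E * W₁ (x 0 - x₁ 0) * (x 1 - (l₁ * x 0 + l₂)) ^ n))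
    (hRm : Measurable R) (hRim : ∀ i, Measurable (Ri i)) (hW₁c : Continuous W₁) (hW₁0 : W₁ 0 ≠ 0)
    {ρW CW : ℝ} (hWb : ∀ u : ℝ, |u| < ρW → |W₁ 0| / 2 ≤ |W₁ u| ∧ |W₁ u| ≤ CW)
    (hfinY : ∫⁻ x in {x | ∀ j, 0 < av x (M j)}, ENNReal.ofReal |R x| * lmass lo hi a (av x) < ∞)
    {p q₀ : ℝ} (hp : |p| = 1) (hq₀ : |q₀| = 1)
    (P Q : Fin 2 → ℝ) (hP : P = ![0, p]) (hQ : Q = ![q₀, q₀ * l₁])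
    {δ₀ ε₀ : ℝ} {KΛ : ℝ≥0∞} (hKΛ : KΛ ≠ ∞)
    (hmono : ∀ δ ε : ℝ, 4 * δ ≤ δ₀ → 4 * ε ≤ ε₀ → ∀ x v x' v' : ℝ, 0 < x → x ≤ x' → x' ≤ 4 * x →
      x' < 4 * δ → 0 < v → v ≤ v' → v' ≤ 4 * v → v' < 4 * ε →
      lmass lo hi a (av (bpt x₁ P Q x v)) ≤ KΛ * lmass lo hi a (av (bpt x₁ P Q x' v')))
    {δ ε : ℝ} (hδ : 0 < δ) (hε : 0 < ε) (h4δ : 4 * δ ≤ δ₀) (h4ε : 4 * ε ≤ ε₀)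
    (hδ1 : 4 * δ ≤ 1) (hεW : 4 * ε ≤ ρW)
    (hsign : (∀ t ∈ Ioo (0 : ℝ) (4 * δ), ∀ v ∈ Ioo (0 : ℝ) (4 * ε),
        bpt x₁ P Q t v ∈ {x : Fin 2 → ℝ | ∀ j, 0 < av x (M j)}) ∨
      (∀ t ∈ Ioo (0 : ℝ) (4 * δ), ∀ v ∈ Ioo (0 : ℝ) (4 * ε),
        bpt x₁ P Q t v ∉ {x : Fin 2 → ℝ | ∀ j, 0 < av x (M j)})) :
    ∫⁻ z in sector x₁ P Q δ (Ico 0 ε), {x : Fin 2 → ℝ | ∀ j, 0 < av x (M j)}.indicator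
      (fun x => (∑ i ∈ Finset.range N, ENNReal.ofReal |Ri i x|) * lmass lo hi a (av x)) z < ∞ := by
  have hYm := measurableSet_Y M
  set m : (Fin 2 → ℝ) → ℝ≥0∞ := fun x => lmass lo hi a (av x) with hm_def
  have hm : Measurable m := measurable_lmass_av lo hi a
  have hp0 : p ≠ 0 := sigma_ne_zero hp
  have hq0 : q₀ ≠ 0 := sigma_ne_zero hq₀
  have hdet : P 0 * Q 1 - Q 0 * P 1 ≠ 0 := by
    rw [hP, hQ, vframe_det]; exact neg_ne_zero.2 (mul_ne_zero hq0 hp0)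
  rcases hsign with hin4 | hout
  swap
  · rw [sector_zero N x₁ P Q hYm hm hRim hdet fun t ht v hv => hout t (Ioo_four hδ ht) v (Ioo_four hε hv)]
    exact ENNReal.zero_lt_top
  have hin : ∀ t ∈ Ioo (0 : ℝ) δ, ∀ v ∈ Ioo (0 : ℝ) ε,
      bpt x₁ P Q t v ∈ {x : Fin 2 → ℝ | ∀ j, 0 < av x (M j)} := fun t ht v hv =>
    hin4 t (Ioo_four hδ ht) v (Ioo_four hε hv)
  refine sector_finite N x₁ P Q hYm hm hRim hdet hin ?_
  have hfin := hfin_of_inside x₁ P Q hm hRm hfinY hdet hin4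
  -- the data of the ray theorem
  set T := Finset.range N ×ˢ Finset.range N' with hT
  set κ' : ℕ × ℕ → ℝ := fun im => cc im * q₀ ^ im.2 * p ^ im.1 with hκ'
  set ω : ℝ → ℝ → ℝ := fun t v => |q₀| ^ E * |p| ^ n * |W₁ (t * (v * q₀))| with hω_def
  set Λ' : ℝ → ℝ → ℝ≥0∞ := fun t v => m (bpt x₁ P Q t v) with hΛ'
  have hωm : Measurable (Function.uncurry ω) := by
    refine Measurable.const_mul ?_ _
    exact continuous_abs.measurable.comp (hW₁c.measurable.comp
      (measurable_fst.mul (measurable_snd.mul_const _)))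
  have hΛm : Measurable (Function.uncurry Λ') := measurable_lmass_bpt lo hi a x₁ P Q
  have hWt : ∀ t ∈ Ioo (0 : ℝ) (4 * δ), ∀ v ∈ Ioo (0 : ℝ) (4 * ε),
      |W₁ 0| / 2 ≤ |W₁ (t * (v * q₀))| ∧ |W₁ (t * (v * q₀))| ≤ CW := by
    intro t ht v hv
    refine hWb _ ?_
    rw [abs_mul, abs_mul, abs_of_pos ht.1, abs_of_pos hv.1, hq₀, mul_one]
    calc t * v < 4 * δ * (4 * ε) := mul_lt_mul'' ht.2 hv.2 ht.1.le hv.1.le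
      _ ≤ 1 * (4 * ε) := mul_le_mul_of_nonneg_right hδ1 (by linarith)
      _ ≤ ρW := by linarith
  have hW0 : 0 < |W₁ 0| / 2 := half_pos (abs_pos.2 hW₁0)
  have hc0 : 0 < |q₀| ^ E * |p| ^ n :=
    mul_pos (pow_pos (abs_pos.2 hq0) E) (pow_pos (abs_pos.2 hp0) n)
  have hωlo : 0 < |q₀| ^ E * |p| ^ n * (|W₁ 0| / 2) := mul_pos hc0 hW0
  have hω : ∀ t ∈ Ioo (0 : ℝ) (4 * δ), ∀ v ∈ Ioo (0 : ℝ) (4 * ε),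
      |q₀| ^ E * |p| ^ n * (|W₁ 0| / 2) ≤ ω t v ∧ ω t v ≤ |q₀| ^ E * |p| ^ n * CW := fun t ht v hv =>
    ⟨mul_le_mul_of_nonneg_left (hWt t ht v hv).1 hc0.le,
      mul_le_mul_of_nonneg_left (hWt t ht v hv).2 hc0.le⟩
  have hden : ∀ t ∈ Ioo (0 : ℝ) (4 * δ), ∀ v ∈ Ioo (0 : ℝ) (4 * ε),
      |(t * (v * q₀)) ^ E * W₁ (t * (v * q₀)) * (t * p) ^ n| = t ^ (E + n) * |v| ^ E * ω t v ∧
      0 < t ^ (E + n) * |v| ^ E * ω t v := fun t ht v hv =>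
    vframe_den ht.1 hv.1 (hW0.trans_le (hWt t ht v hv).1) hp0 hq0
  -- the integrand and the pieces in blown-up coordinates
  have hR' : ∀ t ∈ Ioo (0 : ℝ) (4 * δ), ∀ v ∈ Ioo (0 : ℝ) (4 * ε),
      ENNReal.ofReal t * (ENNReal.ofReal |R (bpt x₁ P Q t v)| * m (bpt x₁ P Q t v)) =
        ENNReal.ofReal |usum T κ' Prod.snd t (0 + 1 * v)| * wt (E + n) E 0 1 ω Λ' t v := by
    intro t ht v hv
    rw [hR, hP, hQ, vframe_fst, vframe_lam, hlam, zero_add, dsum_snd cc N N' q₀ p t v]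
    simp only [wt, phi, zero_add, one_mul]
    rw [← hP, ← hQ]
    exact piece_eq_wt ht.1.le rfl (hden t ht v hv).1 (hden t ht v hv).2 _
  have hRi' : ∀ i ∈ Finset.range N, ∀ t ∈ Ioo (0 : ℝ) δ, ∀ v ∈ Ioo (0 : ℝ) ε,
      ENNReal.ofReal t * (ENNReal.ofReal |Ri i (bpt x₁ P Q t v)| * m (bpt x₁ P Q t v)) =
        ENNReal.ofReal |usum (T.filter fun im => im.1 = i) κ' Prod.snd t (0 + 1 * v)| *
          wt (E + n) E 0 1 ω Λ' t v := by
    intro i hi t ht v hv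
    rw [hRi i hi, hP, hQ, vframe_fst, vframe_lam, hlam, zero_add,
      piece_snd cc N N' q₀ p t v i (Finset.mem_range.1 hi)]
    simp only [wt, phi, zero_add, one_mul]
    rw [← hP, ← hQ]
    exact piece_eq_wt ht.1.le rfl (hden t (Ioo_four hδ ht) v (Ioo_four hε hv)).1
      (hden t (Ioo_four hδ ht) v (Ioo_four hε hv)).2 _
  have hmono' := hmono δ ε h4δ h4ε
  exact step_pole N x₁ P Q T κ' Prod.snd (E + n) E 0 1 ω Λ' hR' hRi'
    (ray_pole_zero T κ' Prod.snd (N + N') (deg_prod N N') (snd_le_prod N N') (inj_snd T) (E + n) E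
      abs_one hωm hΛm hωlo hω KΛ hKΛ hmono') hfin

end SepTwo

/-- **The density on a vertical thin sector at a point of the pole line is finite** (registered
part of `stub_separateTwoPos_hI`; restatement of `SepTwo.vsector_pole`). -/
theorem separateTwo_hiPole {k m' : ℕ} (M : Fin m' → SepTwo.Atm 2) (lo hi : Fin k → Fin k ⊕ SepTwo.Atm 2) (a : Fin k → Option (SepTwo.Atm 2)) (N N' : ℕ) (cc : ℕ × ℕ → ℝ) (E n : ℕ) (W₁ : ℝ → ℝ) (l₁ l₂ : ℝ) (x₁ : Fin 2 → ℝ) (R : (Fin 2 → ℝ) → ℝ) (Ri : ℕ → (Fin 2 → ℝ) → ℝ) (hlam : x₁ 1 - (l₁ * x₁ 0 + l₂) = 0) (hR : ∀ x, R x = (∑ i ∈ Finset.range N, (∑ m ∈ Finset.range N', cc (i, m) * (x 0 - x₁ 0) ^ m) * (x 1 - (l₁ * x 0 + l₂)) ^ i) / ((x 0 - x₁ 0) ^ E * W₁ (x 0 - x₁ 0) * (x 1 - (l₁ * x 0 + l₂)) ^ n)) (hRi : ∀ i ∈ Finset.range N, ∀ x, Ri i x = (∑ m ∈ Finset.range N',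 cc (i, m) * (x 0 - x₁ 0) ^ m) * (x 1 - (l₁ * x 0 + l₂)) ^ i / ((x 0 - x₁ 0) ^ E * W₁ (x 0 - x₁ 0) * (x 1 - (l₁ * x 0 + l₂)) ^ n)) (hRm : Measurable R) (hRim : ∀ i, Measurable (Ri i)) (hW₁c : Continuous W₁) (hW₁0 : W₁ 0 ≠ 0) {ρW CW : ℝ} (hWb : ∀ u : ℝ, |u| < ρW → |W₁ 0| / 2 ≤ |W₁ u| ∧ |W₁ u| ≤ CW) (hfinY : MeasureTheory.lintegral (MeasureTheory.volume.restrict {x | ∀ j, 0 < SepTwo.av x (M j)}) (fun x => ENNReal.ofReal |R x| * SepTwo.lmass lo hi a (SepTwo.av x)) < ⊤) {p q₀ : ℝ} (hp : |p| = 1) (hq₀ : |q₀| = 1) (P Q : Fin 2 → ℝ) (hP : P = ![0, p]) (hQ : Q = ![q₀, q₀ * l₁]) {δ₀ ε₀ : ℝ} {KΛ : ENNReal} (hKΛ : KΛ ≠ ⊤) (hmono : ∀ δ ε : ℝ, 4 * δ ≤ δ₀ → 4 * ε ≤ ε₀ → ∀ x v x' v' : ℝ, 0 < x → x ≤ x'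 → x' ≤ 4 * x → x' < 4 * δ → 0 < v → v ≤ v' → v' ≤ 4 * v → v' < 4 * ε → SepTwo.lmass lo hi a (SepTwo.av (SepTwo.bpt x₁ P Q x v)) ≤ KΛ * SepTwo.lmass lo hi a (SepTwo.av (SepTwo.bpt x₁ P Q x' v'))) {δ ε : ℝ} (hδ : 0 < δ) (hε : 0 < ε) (h4δ : 4 * δ ≤ δ₀) (h4ε : 4 * ε ≤ ε₀) (hδ1 : 4 * δ ≤ 1) (hεW : 4 * ε ≤ ρW) (hsign : (∀ t ∈ Set.Ioo (0 : ℝ) (4 * δ), ∀ v ∈ Set.Ioo (0 : ℝ) (4 * ε), SepTwo.bpt x₁ P Q t v ∈ {x : Fin 2 → ℝ | ∀ j, 0 < SepTwo.av x (M j)}) ∨ (∀ t ∈ Set.Ioo (0 : ℝ) (4 * δ), ∀ v ∈ Set.Ioo (0 : ℝ) (4 * ε), SepTwo.bpt x₁ P Q t v ∉ {x : Fin 2 → ℝ | ∀ j, 0 < SepTwo.av x (M j)})) : MeasureTheory.lintegral (MeasureTheory.volume.restrict (SepTwo.sector x₁ P Q δ (Set.Ico 0 ε))) (fun z => {x : Fin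 2 → ℝ | ∀ j, 0 < SepTwo.av x (M j)}.indicator (fun x => (∑ i ∈ Finset.range N, ENNReal.ofReal |Ri i x|) * SepTwo.lmass lo hi a (SepTwo.av x)) z) < ⊤ := by
  exact SepTwo.vsector_pole M lo hi a N N' cc E n W₁ l₁ l₂ x₁ R Ri hlam hR hRi hRm hRim hW₁c hW₁0 hWb hfinY hp hq₀ P Q hP hQ hKΛ hmono hδ hε h4δ h4ε hδ1 hεW hsign

end Summit.KontsevichZagierPeriods.ArrangementNormalForm.JanusBands
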